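import Mathlib.AlgebraicGeometry.Morphisms.QuasiFinite
import Mathlib.AlgebraicGeometry.Morphisms.FlatRank
import Mathlib.AlgebraicGeometry.Noetherian
import HarnessLib

/-!
# Shrinking the base of a finite cover, and the degree of a finite flat cover of an irreducible base

Two elementary facts about a finite morphism `ν : T' → T` used when a statement known over a
dense open subset `U'' ⊆ T'` of an irreducible finite cover is to be pushed down to a dense open
subset of the base (Voisin, *Hodge Theory and Complex Algebraic Geometry II*, proof of
Thm. 10.19: "Then `U` contains a Zariski open set of the form `p^{-1}(V)`, where `V` is a Zariski
open set in `Y`" and "we may assume that `p` is generically finite of degree `N`"):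

* `exists_opens_preimage_le_of_isFinite`: for `ν` finite with `T'` irreducible and a non-empty
  open `U'' ⊆ T'` there is a non-empty open `U ⊆ T` with `ν⁻¹(U) ⊆ U''` — namely
  `U = T ∖ ν(T' ∖ U'')` (`ν` is closed), which contains `ν(η_{T'})` because the fibres of a
  finite morphism are discrete (Mathlib `Scheme.Hom.isDiscrete_preimage_singleton`), so that no
  point of `T' ∖ U''` (a specialisation of `η_{T'}` other than `η_{T'}`) maps to `ν(η_{T'})`.
* `exists_pos_finrank_eq_of_preconnectedSpace`: a surjective finite flat morphism of finite
  presentation onto a preconnected base has constant positive degree (Mathlib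
  `Scheme.Hom.isLocallyConstant_finrank`, `Scheme.Hom.one_le_finrank_iff_surjective`).
* `isGenericPoint_base_genericPoint`: a dominant morphism from an irreducible scheme maps the
  generic point to a generic point.

Everything is proved; [folklore].
-/

noncomputable section

universe u

open CategoryTheory AlgebraicGeometry TopologicalSpace Topology

namespace Literature.AlgebraicGeometry.Morphisms

/-- **Shrinking the base of a finite cover.** For a finite morphism `ν : T' → T` from an
irreducible scheme and a non-empty open `U'' ⊆ T'`, there is a non-empty open `U ⊆ T` with
`ν⁻¹(U) ⊆ U''`: take `U = T ∖ ν(T' ∖ U'')`, open as `ν` is closed; it contains `ν(η_{T'})`, for a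
point `t' ∉ U''` with `ν(t') = ν(η_{T'})` would be a specialisation of `η_{T'}` in the same
(discrete) fibre, hence equal to `η_{T'} ∈ U''` (Voisin II, proof of Thm. 10.19: "`U` contains a
Zariski open set of the form `p^{-1}(V)`"). [folklore] -/
theorem exists_opens_preimage_le_of_isFinite {T' T : Scheme.{u}} (ν : T' ⟶ T) [IsFinite ν]
    [IrreducibleSpace T'] (U'' : T'.Opens) (hU'' : (U'' : Set T').Nonempty) :
    ∃ U : T.Opens, (U : Set T).Nonempty ∧ ν ⁻¹ᵁ U ≤ U'' := by
  have hF : IsClosed (ν.base '' (U'' : Set T')ᶜ) := ν.isClosedMap _ U''.isOpen.isClosed_compl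
  have hηU : genericPoint T' ∈ U'' :=
    ((genericPoint_spec T').mem_open_set_iff U''.isOpen).mpr (by simpa using hU'')
  refine ⟨⟨(ν.base '' (U'' : Set T')ᶜ)ᶜ, hF.isOpen_compl⟩, ⟨ν.base (genericPoint T'), ?_⟩, ?_⟩
  · rintro ⟨t', ht', heq⟩
    apply ht'
    have hspec : genericPoint T' ⤳ t' := genericPoint_specializes t'
    have ht'eq : genericPoint T' = t' :=
      (ν.isDiscrete_preimage_singleton (ν.base (genericPoint T'))).eq_of_specializes hspec
        rfl heq
    rw [← ht'eq]
    exact hηU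
  · intro x hx
    by_contra hxU
    exact hx ⟨x, hxU, rfl⟩

/-- **The degree of a finite flat cover of a preconnected base.** A surjective finite flat
morphism of finite presentation `p : U' → U` onto a non-empty preconnected scheme has constant
positive degree: the rank of `p_* 𝒪_{U'}` (Mathlib `Scheme.Hom.finrank`, Stacks 02KA) is locally
constant, hence constant, and positive as `p` is surjective (Voisin II, proof of Thm. 10.19:
"generically finite of degree `N`"; Fulton, Example 1.7.4: "`f` has degree `d`"). [folklore] -/
theorem exists_pos_finrank_eq_of_preconnectedSpace {U' U : Scheme.{u}} (p : U' ⟶ U) [IsFinite p]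
    [Flat p] [LocallyOfFinitePresentation p] [Surjective p] [PreconnectedSpace U] [Nonempty U] :
    ∃ N : ℕ, 0 < N ∧ ∀ u : U, p.finrank u = N := by
  obtain ⟨u₀⟩ := ‹Nonempty U›
  refine ⟨p.finrank u₀, ?_, fun u ↦ ?_⟩
  · have h := (Scheme.Hom.one_le_finrank_iff_surjective (f := p)).mpr inferInstance
    exact h u₀
  · exact p.isLocallyConstant_finrank.apply_eq_of_isPreconnected isPreconnected_univ
      (Set.mem_univ u) (Set.mem_univ u₀)

/-- **A dominant morphism from an irreducible scheme sends the generic point to a generic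
point** (the closure of `ν(η_{T'})` contains `ν(T')`, which is dense). [folklore] -/
theorem isGenericPoint_base_genericPoint {T' T : Scheme.{u}} (ν : T' ⟶ T) [IrreducibleSpace T']
    (hν : DenseRange ν.base) : IsGenericPoint (ν.base (genericPoint T')) (Set.univ : Set T) := by
  have h := (genericPoint_spec T').image ν.continuous
  rw [Set.image_univ, hν.closure_range] at h
  exact h

/-- For a dominant morphism between integral schemes, `ν(η_{T'}) = η_T`. [folklore] -/
theorem base_genericPoint_eq {T' T : Scheme.{u}} (ν : T' ⟶ T) [IrreducibleSpace T']
    [IrreducibleSpace T] (hν : DenseRange ν.base) :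
    ν.base (genericPoint T') = genericPoint T := by
  have h := isGenericPoint_base_genericPoint ν hν
  exact h.eq (by simpa using genericPoint_spec T)

end Literature.AlgebraicGeometry.Morphisms

end
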